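import Summits.KontsevichZagierPeriods.KontsevichZagierPeriods.Theorems.RootDecompWalshStrataConicDouble01

/-!
# Root decomposition & Walsh strata — the conic-wall terminal, part 5b: the double-root radicand (gen 8, §36.9)

Route `RootDecompWalshStrata`, leaf `QuadricBakerDescent` (stmt-27597), residual R-E2 (NODE.md, decomp-kz-lens-4).
The last stratum of the conic-wall height terminal: `δe ≠ 0` and `4δeδg = δf²`, i.e. the radicand of the
branch is a SQUARE `δ = δe(Y − y₀)²` (`y₀ = −δf/(2δe) ∈ ℚ`; the wall conic degenerates to a pair of
lines through a point at height `y₀`).  Then `√δ = √δe·|Y − y₀|` and on each side of `y₀` the function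
`Λ` is AFFINE in `Y` with the (generally irrational) slope `σ/k`, `σ = aκ₀l₂ ± l₁√δe`.  If `σ = 0`
the integrand is a scaled simple pole `c'√δe/(Y − y₀)` (`InBaker.sqrt_const_pole`); otherwise the
single `ℚ`-semialgebraic chart `Y ↦ t = Λ(Y)/λ` (the irrational Jacobian cancels against
`√δ = √δe|kΛ − P(y₀)|/|σ|`) turns it into `√δe · C₁t³(l₀λt − c)/((kλt − P(y₀))(λ²t² − c))` on
`|t| ≤ 1`, and `ℚ`-partial fractions (an explicit Bezout identity between the coprime factors and one
division by `X − a₁`, `a₁ = P(y₀)/(kλ)`) split it into the scaled class `M(t)/(λ²t² − c)·√δe`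
(`InBaker.sqrt_const_div_W_sym`) plus a scaled simple pole — the pole is the UNPEELED remainder, so
no hull condition at `y₀` is needed (`InBaker.conic_terminal_signed_double`).
[KontsevichZagier2001 §1.2; this node]
-/

noncomputable section

open Set MeasureTheory Literature.NumberTheory.Transcendental
open Literature.ModelTheory.ExponentialFields (IsSemialgebraic isSemialgebraic_univ)

namespace Summit.KontsevichZagierPeriods.RootDecompWalshStrata.ConicDescent

/-! #### 36.9b The double-root stratum, signed -/

set_option maxHeartbeats 400000 in
/-- The pulled-back integrand of the double-root stratum under the chart `Y ↦ t = Λ/λ`. -/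
private theorem double_identity (γ s l₀ c lam k p₁ σ τ ι u t : ℝ) (hu : u ≠ 0) (hσ : σ ≠ 0)
    (hτ : τ = 1 ∨ τ = -1) (hι : ι = 1 ∨ ι = -1) (habs : |σ| = ι * σ)
    (_hD₁ : k * lam * t - p₁ ≠ 0) (hD₂ : -c + lam ^ 2 * t ^ 2 ≠ 0) :
    γ * s * lam ^ 3 * |k * lam| * (ι * τ) / (3 * u ^ 2) * (t ^ 3 * (l₀ * lam * t - c)) /
        ((k * lam * t - p₁) * (-c + lam ^ 2 * t ^ 2)) * u =
      γ * s / 3 * (lam * t) ^ 3 * (l₀ * (lam * t) - c) /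
        (τ * u * ((k * lam * t - p₁) / σ) * ((lam * t) ^ 2 - c)) * |k * lam / σ| := by
  have hD' : (lam * t) ^ 2 - c = -c + lam ^ 2 * t ^ 2 := by ring
  rw [hD', abs_div, habs]
  rcases hτ with rfl | rfl <;> rcases hι with rfl | rfl <;> field_simp

/-- The scaled simple pole of the sub-case `σ = 0`. -/
private theorem pole_identity (γ s l₀ c Λ₀ τ u d : ℝ) (hu : u ≠ 0) (hτ : τ = 1 ∨ τ = -1)
    (hd : d ≠ 0) (hΛ : Λ₀ ^ 2 - c ≠ 0) :
    γ * s / 3 * Λ₀ ^ 3 * (l₀ * Λ₀ - c) / (τ * u * d * (Λ₀ ^ 2 - c)) =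
      γ * s * Λ₀ ^ 3 * (l₀ * Λ₀ - c) * τ / (3 * u ^ 2 * (Λ₀ ^ 2 - c)) / d * u := by
  rcases hτ with rfl | rfl <;> field_simp

/-- The `ℚ`-partial-fraction split of the pulled-back integrand (`kλt − p₁ = kλ(t − a₁)`,
`d₀ = λ²a₁² − c`, `N/d₀ = A₀ + (t − a₁)·q`). -/
private theorem double_peel_identity (C₁ k lam a₁ c l₀ d₀ q A₀ u t : ℝ) (hkl : k * lam ≠ 0)
    (ht : t - a₁ ≠ 0) (hD₂ : -c + lam ^ 2 * t ^ 2 ≠ 0) (hd₀ : d₀ = lam ^ 2 * a₁ ^ 2 - c)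
    (hd₀0 : d₀ ≠ 0) (hN : t ^ 3 * (l₀ * lam * t - c) = d₀ * (A₀ + (t - a₁) * q)) :
    C₁ * (t ^ 3 * (l₀ * lam * t - c)) / ((k * lam * t - k * lam * a₁) * (-c + lam ^ 2 * t ^ 2)) * u =
      C₁ / (k * lam) * (q * (-c + lam ^ 2 * t ^ 2) - lam ^ 2 / d₀ * (t ^ 3 * (l₀ * lam * t - c)) *
        (t + a₁)) / (-c + lam ^ 2 * t ^ 2) * u + C₁ / (k * lam) * A₀ / (t - a₁) * u := by
  rw [hN]
  subst hd₀
  have h1 : k * lam * t - k * lam * a₁ ≠ 0 := by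
    rw [← mul_sub]; exact mul_ne_zero hkl ht
  field_simp
  ring

/-- **The double-root radicand stratum, signed, on one side of `y₀`.** `δe ≠ 0`, `4δeδg = δf²`,
`c < 0`, a bounded domain on which `τ(Y − y₀) > 0` (`τ = ±1`): the signed terminal integrand is in
`InBaker`.  [this node] -/
theorem InBaker.conic_terminal_signed_double (W : ConicWall) (γ s : ℚ) (hk : W.k ≠ 0)
    (hc : W.c < 0) (he : W.δe ≠ 0) (hdr : 4 * W.δe * W.δg = W.δf ^ 2) (τ : ℚ) (hτ : τ = 1 ∨ τ = -1)
    (lo hi : ℚ) (r : KZ.IntegralRep 1) (hdom : ∀ v ∈ r.domain, (lo : ℝ) ≤ v 0 ∧ v 0 ≤ hi)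
    (hside : ∀ v ∈ r.domain, 0 < (τ : ℝ) * (v 0 - ((-W.δf / (2 * W.δe) : ℚ) : ℝ)))
    (hδ : ∀ v ∈ r.domain, 0 < W.δ (v 0))
    (hr : EqOn r.integrand (fun v => (γ * s / 3 : ℝ) * W.Λ (v 0) ^ 3 *
      (W.l₀ * W.Λ (v 0) - W.c) / (√(W.δ (v 0)) * (W.Λ (v 0) ^ 2 - W.c))) r.domain) :
    InBaker (KZ.of r) := by
  rcases r.domain.eq_empty_or_nonempty with h0 | ⟨v₀, hv₀⟩
  · exact InBaker.of_domain_eq_empty r h0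
  have hk' : (W.k : ℝ) ≠ 0 := by exact_mod_cast hk
  have hc' : (W.c : ℝ) < 0 := by exact_mod_cast hc
  have he' : (W.δe : ℝ) ≠ 0 := by exact_mod_cast he
  have hτ' : (τ : ℝ) = 1 ∨ (τ : ℝ) = -1 := by
    rcases hτ with h | h <;> simp [h]
  -- the double root `y₀`, `δ = e(Y − y₀)²`
  obtain ⟨e, hedef⟩ : ∃ e : ℚ, e = W.δe := ⟨_, rfl⟩
  obtain ⟨y₀, hy₀def⟩ : ∃ y₀ : ℚ, y₀ = -W.δf / (2 * W.δe) := ⟨_, rfl⟩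
  rw [← hy₀def] at hside
  have hδsq : ∀ y : ℝ, W.δ y = e * (y - y₀) ^ 2 := fun y => by
    have h4 : (W.δg : ℝ) = W.δf ^ 2 / (4 * W.δe) := by
      have h : (4 * W.δe * W.δg : ℝ) = W.δf ^ 2 := by exact_mod_cast hdr
      field_simp
      linear_combination h
    rw [W.δ_eq_qD, hedef, hy₀def]
    simp only [qD]
    rw [h4]
    push_cast
    field_simp
    ring
  -- `e > 0` (the domain is non-empty and misses `y₀`), `u = √e`
  have hne : ∀ v ∈ r.domain, v 0 - (y₀ : ℝ) ≠ 0 := fun v hv h => by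
    have h2 := hside v hv
    rw [h, mul_zero] at h2
    exact lt_irrefl _ h2
  have hepos' : (0 : ℝ) < e := by
    have h1 := hδ v₀ hv₀
    rw [hδsq] at h1
    have h3 : (0 : ℝ) < (v₀ 0 - y₀) ^ 2 := by have := hne v₀ hv₀; positivity
    exact pos_of_mul_pos_left h1 h3.le
  have hepos : 0 < e := by exact_mod_cast hepos'
  set u := √(e : ℝ) with hu_def
  have hu0 : 0 < u := Real.sqrt_pos.2 hepos'
  have huu : u ^ 2 = e := Real.sq_sqrt hepos'.le
  have hsqrtδ : ∀ y : ℝ, 0 < (τ : ℝ) * (y - y₀) → √(W.δ y) = τ * u * (y - y₀) := fun y hy => by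
    rw [hδsq, Real.sqrt_mul' _ (sq_nonneg _), Real.sqrt_sq_eq_abs, ← hu_def]
    rcases hτ with rfl | rfl
    · push_cast at hy ⊢
      rw [abs_of_pos (by linarith)]
      ring
    · push_cast at hy ⊢
      rw [abs_of_neg (by linarith)]
      ring
  -- `P = p₁ + α(Y − y₀)`, `Λ = (p₁ + σ(Y − y₀))/k` on the side, `σ = α + τl₁u`
  obtain ⟨α, hαdef⟩ : ∃ α : ℚ, α = W.a * W.κ₀ * W.l₂ := ⟨_, rfl⟩
  obtain ⟨p₁, hp₁def⟩ : ∃ p₁ : ℚ, p₁ = W.a * W.κ₀ * (W.l₀ + W.l₂ * y₀) := ⟨_, rfl⟩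
  have hP : ∀ y : ℝ, W.P y = p₁ + α * (y - y₀) := fun y => by
    rw [hp₁def, hαdef]
    simp only [ConicWall.P, ConicWall.L]
    push_cast
    ring
  obtain ⟨σ, hσdef⟩ : ∃ σ : ℝ, σ = (α : ℝ) + τ * W.l₁ * u := ⟨_, rfl⟩
  have hΛside : ∀ y : ℝ, 0 < (τ : ℝ) * (y - y₀) →
      W.Λ y = ((p₁ : ℝ) + σ * (y - y₀)) / W.k := fun y hy => by
    simp only [ConicWall.Λ]
    rw [hP, hsqrtδ y hy, hσdef]
    ring
  have hΛc0 : ∀ t : ℝ, t ^ 2 - W.c ≠ 0 := fun t => by nlinarith [sq_nonneg t]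
  have hqD : ∀ x : ℝ, qD 0 0 e x = e := fun x => by simp [qD]
  by_cases hσ0 : σ = 0
  · -- `Λ ≡ Λ₀ = p₁/k`: a scaled simple pole at `y₀`
    obtain ⟨Λ₀, hΛ₀def⟩ : ∃ Λ₀ : ℚ, Λ₀ = p₁ / W.k := ⟨_, rfl⟩
    have hΛ₀ : ∀ v ∈ r.domain, W.Λ (v 0) = Λ₀ := fun v hv => by
      rw [hΛside _ (hside v hv), hσ0, hΛ₀def]
      push_cast
      ring
    have hΛ₀c : (Λ₀ : ℝ) ^ 2 - W.c ≠ 0 := hΛc0 _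
    refine InBaker.sqrt_const_pole e y₀
      (γ * s * Λ₀ ^ 3 * (W.l₀ * Λ₀ - W.c) * τ / (3 * e * (Λ₀ ^ 2 - W.c))) hepos r fun v hv => ?_
    rw [hr hv]
    beta_reduce
    rw [hΛ₀ v hv, hsqrtδ _ (hside v hv), hqD, ← hu_def]
    push_cast
    rw [← huu]
    exact pole_identity (γ : ℝ) s W.l₀ W.c Λ₀ τ u (v 0 - y₀) hu0.ne' hτ' (hne v hv) hΛ₀c
  · -- `σ ≠ 0`: the chart `Y ↦ t = Λ(Y)/λ`
    obtain ⟨ι, hι, hιabs⟩ : ∃ ι : ℚ, (ι = 1 ∨ ι = -1) ∧ |σ| = (ι : ℝ) * σ := by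
      rcases lt_or_gt_of_ne hσ0 with h | h
      · exact ⟨-1, Or.inr rfl, by rw [abs_of_neg h]; push_cast; ring⟩
      · exact ⟨1, Or.inl rfl, by rw [abs_of_pos h]; push_cast; ring⟩
    have hι' : (ι : ℝ) = 1 ∨ (ι : ℝ) = -1 := by
      rcases hι with h | h <;> simp [h]
    -- a bound `B` for `|Λ|` on the domain and a rational scale `lam > max B 1`
    obtain ⟨B, hBdef⟩ : ∃ B : ℝ,
        B = (|(p₁ : ℝ) - σ * y₀| + |σ| * max |(lo : ℝ)| |(hi : ℝ)|) / |(W.k : ℝ)| := ⟨_, rfl⟩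
    have hΛB : ∀ v ∈ r.domain, |W.Λ (v 0)| ≤ B := fun v hv => by
      rw [hΛside _ (hside v hv), hBdef, abs_div,
        show (p₁ : ℝ) + σ * (v 0 - y₀) = ((p₁ : ℝ) - σ * y₀) + σ * v 0 by ring]
      refine div_le_div_of_nonneg_right ((abs_add_le _ _).trans (add_le_add le_rfl ?_))
        (abs_nonneg _)
      rw [abs_mul]
      exact mul_le_mul_of_nonneg_left (abs_le_max_abs_abs (hdom v hv).1 (hdom v hv).2)
        (abs_nonneg _)
    obtain ⟨lam, hlam⟩ := exists_rat_gt (max B 1)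
    have hlam1 : (1 : ℝ) < lam := (le_max_right _ _).trans_lt hlam
    have hlamB : B < lam := (le_max_left _ _).trans_lt hlam
    have hlam0 : (0 : ℝ) < lam := one_pos.trans hlam1
    have hlam0' : (lam : ℝ) ≠ 0 := hlam0.ne'
    have hkl : (W.k : ℝ) * lam ≠ 0 := mul_ne_zero hk' hlam0'
    have hklq : W.k * lam ≠ 0 := by exact_mod_cast hkl
    -- the chart `g(t) = y₀ + (kλt − p₁)/σ`
    obtain ⟨g, hgdef⟩ : ∃ g : ℝ → ℝ,
        g = fun t => (y₀ : ℝ) + ((W.k : ℝ) * lam * t - p₁) / σ := ⟨_, rfl⟩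
    have hgy : ∀ t, g t - y₀ = ((W.k : ℝ) * lam * t - p₁) / σ := fun t => by rw [hgdef]; ring
    have hΛg : ∀ t, 0 < (τ : ℝ) * (g t - y₀) → W.Λ (g t) = lam * t := fun t ht => by
      rw [hΛside _ ht, hgy]
      field_simp
      ring
    have hgΛ : ∀ v ∈ r.domain, g (W.Λ (v 0) / lam) = v 0 := fun v hv => by
      rw [hΛside _ (hside v hv), hgdef]
      beta_reduce
      field_simp
      ring
    -- the semialgebraic side `T₀ = {ιτ(kλt − p₁) > 0}` of the pole `t = a₁`
    have hU : IsSemialgebraic ℚ (univ : Set (Fin 1 → ℝ)) := isSemialgebraic_univ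
    have hD₁sa : IsSemialgebraicFunOn ℚ (univ : Set (Fin 1 → ℝ))
        fun v => ((ι * τ : ℚ) : ℝ) * ((W.k : ℝ) * lam * v 0 - p₁) :=
      (((isSemialgebraicFunOn_ratCast hU (ι * τ * (W.k * lam))).mul_holds
        (isSemialgebraicFunOn_apply hU 0)).sub_holds
        (isSemialgebraicFunOn_ratCast hU (ι * τ * p₁))).congr fun v _ => by
        simp only [Pi.mul_apply, Pi.sub_apply]
        push_cast
        ring
    have hT₀ : IsSemialgebraic ℚ {v | v ∈ (univ : Set (Fin 1 → ℝ)) ∧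
        0 < ((ι * τ : ℚ) : ℝ) * ((W.k : ℝ) * lam * v 0 - p₁)} :=
      IsSemialgebraicFunOn.isSemialgebraic_sep_pos hD₁sa
    have hT₀D₁ : ∀ v ∈ {v | v ∈ (univ : Set (Fin 1 → ℝ)) ∧
        0 < ((ι * τ : ℚ) : ℝ) * ((W.k : ℝ) * lam * v 0 - p₁)}, (W.k : ℝ) * lam * v 0 - p₁ ≠ 0 :=
      fun v hv h => by
        have h2 := hv.2
        rw [h, mul_zero] at h2
        exact lt_irrefl _ h2
    -- the pulled-back integrand `R(t) = C₁·t³(l₀λt − c)/((kλt − p₁)(λ²t² − c))·√e`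
    obtain ⟨a₁, ha₁def⟩ : ∃ a₁ : ℚ, a₁ = p₁ / (W.k * lam) := ⟨_, rfl⟩
    have hp₁a : (p₁ : ℝ) = W.k * lam * a₁ := by
      rw [ha₁def]
      push_cast
      field_simp
    obtain ⟨C₁, hC₁def⟩ : ∃ C₁ : ℚ,
        C₁ = γ * s * lam ^ 3 * |W.k * lam| * (ι * τ) / (3 * e) := ⟨_, rfl⟩
    obtain ⟨Np, hNp⟩ : ∃ Np : Polynomial ℚ, Np = Polynomial.X ^ 3 *
        (Polynomial.C (W.l₀ * lam) * Polynomial.X - Polynomial.C W.c) := ⟨_, rfl⟩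
    obtain ⟨D₁p, hD₁p⟩ : ∃ D₁p : Polynomial ℚ,
        D₁p = Polynomial.C (W.k * lam) * Polynomial.X - Polynomial.C p₁ := ⟨_, rfl⟩
    obtain ⟨D₂p, hD₂p⟩ : ∃ D₂p : Polynomial ℚ,
        D₂p = Polynomial.C (-W.c) + Polynomial.C (lam ^ 2) * Polynomial.X ^ 2 := ⟨_, rfl⟩
    have hNx : ∀ x : ℝ, Polynomial.aeval x Np = x ^ 3 * (W.l₀ * lam * x - W.c) := fun x => by
      rw [hNp]
      simp only [map_mul, map_sub, map_pow, Polynomial.aeval_C, Polynomial.aeval_X, eq_ratCast]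
    have hD₁x : ∀ x : ℝ, Polynomial.aeval x D₁p = (W.k : ℝ) * lam * x - p₁ := fun x => by
      rw [hD₁p]
      simp only [map_mul, map_sub, Polynomial.aeval_C, Polynomial.aeval_X, eq_ratCast]
    have hD₂x : ∀ x : ℝ, Polynomial.aeval x D₂p = -(W.c : ℝ) + (lam : ℝ) ^ 2 * x ^ 2 := fun x => by
      rw [hD₂p]
      simp only [map_add, map_mul, map_pow, Polynomial.aeval_C, Polynomial.aeval_X, eq_ratCast]
      push_cast
      ring
    have hD₂pos : ∀ x : ℝ, 0 < -(W.c : ℝ) + (lam : ℝ) ^ 2 * x ^ 2 := fun x =>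
      add_pos_of_pos_of_nonneg (neg_pos.2 hc') (by positivity)
    obtain ⟨R, hRdef⟩ : ∃ R : (Fin 1 → ℝ) → ℝ, R = fun v =>
        Polynomial.aeval (v 0) (Polynomial.C C₁ * Np) / Polynomial.aeval (v 0) (D₁p * D₂p) *
          √(qD 0 0 e (v 0)) := ⟨_, rfl⟩
    have hRx : ∀ v : Fin 1 → ℝ, R v = (C₁ : ℝ) * (v 0 ^ 3 * (W.l₀ * lam * v 0 - W.c)) /
        (((W.k : ℝ) * lam * v 0 - p₁) * (-(W.c : ℝ) + (lam : ℝ) ^ 2 * v 0 ^ 2)) * u := fun v => by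
      rw [hRdef]
      beta_reduce
      rw [hqD, ← hu_def, map_mul, map_mul, Polynomial.aeval_C, eq_ratCast, hNx, hD₁x, hD₂x]
    have hRsa : IsSemialgebraicFunOn ℚ {v | v ∈ (univ : Set (Fin 1 → ℝ)) ∧
        0 < ((ι * τ : ℚ) : ℝ) * ((W.k : ℝ) * lam * v 0 - p₁)} R := by
      rw [hRdef]
      exact ((((IsRatOn.polyAeval (Polynomial.C C₁ * Np) IsRatOn.coord).div
        (IsRatOn.polyAeval (D₁p * D₂p) IsRatOn.coord) fun v hv => by
          rw [map_mul, hD₁x, hD₂x]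
          exact mul_ne_zero (hT₀D₁ v hv) (hD₂pos _).ne').isSemialgebraicFunOn hT₀).mul_holds
        (IsSemialgebraicFunOn.sqrt_holds (isSemialgebraicFunOn_qD 0 0 e hT₀))).congr fun v _ => by
        simp only [Pi.mul_apply]
    -- the chart is semialgebraic
    have hgsa : IsSemialgebraicFunOn ℚ {v | v ∈ (univ : Set (Fin 1 → ℝ)) ∧
        0 < ((ι * τ : ℚ) : ℝ) * ((W.k : ℝ) * lam * v 0 - p₁)} fun v => g (v 0) := by
      have hσsa : IsSemialgebraicFunOn ℚ {v | v ∈ (univ : Set (Fin 1 → ℝ)) ∧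
          0 < ((ι * τ : ℚ) : ℝ) * ((W.k : ℝ) * lam * v 0 - p₁)} fun _ => σ :=
        ((isSemialgebraicFunOn_ratCast hT₀ α).add_holds
          ((isSemialgebraicFunOn_ratCast hT₀ (τ * W.l₁)).mul_holds
            (IsSemialgebraicFunOn.sqrt_holds (isSemialgebraicFunOn_ratCast hT₀ e)))).congr
          fun v _ => by
            simp only [Pi.add_apply, Pi.mul_apply, hσdef, hu_def]
            push_cast
            ring
      rw [hgdef]
      exact ((isSemialgebraicFunOn_ratCast hT₀ y₀).add_holds
        ((((isSemialgebraicFunOn_ratCast hT₀ (W.k * lam)).mul_holds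
          (isSemialgebraicFunOn_apply hT₀ 0)).sub_holds
          (isSemialgebraicFunOn_ratCast hT₀ p₁)).div hσsa fun _ _ => hσ0)).congr fun v _ => by
        simp only [Pi.add_apply, Pi.mul_apply, Pi.sub_apply]
        push_cast
        ring
    refine InBaker.of_cov₁' r hT₀ g (fun _ => (W.k : ℝ) * lam / σ) hgsa
      (fun v _ => ?_) (fun a _ b _ hab => ?_) (fun x hx => ⟨fun _ => W.Λ (x 0) / lam, ?_, hgΛ x hx⟩)
      R hRsa (fun v hvT hvd => ?_) fun r₁ hd₁ hi₁ => ?_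
    · -- derivative
      rw [hgdef]
      have h := ((((hasDerivAt_id (v 0)).const_mul ((W.k : ℝ) * lam)).sub_const
        (p₁ : ℝ)).div_const σ).const_add (y₀ : ℝ)
      simpa using h
    · -- injective
      rw [hgdef] at hab
      have h1 : ((W.k : ℝ) * lam * a 0 - p₁) / σ = ((W.k : ℝ) * lam * b 0 - p₁) / σ := by
        simpa using hab
      have h2 : (W.k : ℝ) * lam * a 0 = (W.k : ℝ) * lam * b 0 := by
        have := (div_left_inj' hσ0).1 h1
        linarith
      exact mul_left_cancel₀ hkl h2
    · -- the preimage of a domain point lies in `T₀`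
      refine ⟨mem_univ _, ?_⟩
      have h1 : (W.k : ℝ) * lam * (W.Λ (x 0) / lam) - p₁ = σ * (x 0 - y₀) := by
        rw [hΛside _ (hside x hx)]
        field_simp
        ring
      have h3 : 0 < |σ| := abs_pos.2 hσ0
      rw [hιabs] at h3
      show 0 < ((ι * τ : ℚ) : ℝ) * ((W.k : ℝ) * lam * (W.Λ (x 0) / lam) - p₁)
      rw [h1, show ((ι * τ : ℚ) : ℝ) * (σ * (x 0 - y₀)) = ((ι : ℝ) * σ) * ((τ : ℝ) * (x 0 - y₀)) by
        push_cast; ring]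
      exact mul_pos h3 (hside x hx)
    · -- the pulled-back integrand
      have hvd' : lift₁ g v ∈ r.domain := hvd
      have hsd : 0 < (τ : ℝ) * (g (v 0) - y₀) := by
        simpa only [lift₁_apply] using hside _ hvd'
      have hD₁ : (W.k : ℝ) * lam * v 0 - p₁ ≠ 0 := hT₀D₁ v hvT
      rw [hr hvd', hRx]
      simp only [lift₁_apply]
      rw [hΛg _ hsd, hsqrtδ _ hsd, hgy, hC₁def]
      push_cast
      rw [← huu]
      exact double_identity (γ : ℝ) s W.l₀ W.c lam W.k p₁ σ τ ι u (v 0) hu0.ne' hσ0 hτ' hι' hιabs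
        hD₁ (hD₂pos _).ne'
    · -- the pulled-back representation: `|t| ≤ 1`, `t ≠ a₁`
      have hb₁ : ∀ v ∈ r₁.domain, |v 0| ≤ 1 := fun v hv => by
        rw [hd₁] at hv
        have hvd : lift₁ g v ∈ r.domain := hv.2
        have hsd : 0 < (τ : ℝ) * (g (v 0) - y₀) := by
          simpa only [lift₁_apply] using hside _ hvd
        have h1 := hΛB _ hvd
        simp only [lift₁_apply] at h1
        rw [hΛg _ hsd, abs_mul, abs_of_pos hlam0] at h1
        have h2 : (lam : ℝ) * |v 0| ≤ lam * 1 := by linarith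
        exact le_of_mul_le_mul_left h2 hlam0
      have hD₁' : ∀ v ∈ r₁.domain, (W.k : ℝ) * lam * v 0 - p₁ ≠ 0 := fun v hv => by
        rw [hd₁] at hv
        exact hT₀D₁ v hv.1
      -- `ℚ`-partial fractions: `d₀ = λ²a₁² − c`, `N/d₀ = A₀ + (X − a₁)·QA`
      obtain ⟨d₀, hd₀def⟩ : ∃ d₀ : ℚ, d₀ = lam ^ 2 * a₁ ^ 2 - W.c := ⟨_, rfl⟩
      have hd₀pos : 0 < d₀ := by rw [hd₀def]; nlinarith [sq_nonneg (lam * a₁)]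
      have hd₀0 : d₀ ≠ 0 := hd₀pos.ne'
      have hd₀0' : (d₀ : ℝ) ≠ 0 := by exact_mod_cast hd₀0
      obtain ⟨QA, A₀, hdiv⟩ : ∃ (QA : Polynomial ℚ) (A₀ : ℚ),
          Polynomial.C A₀ + (Polynomial.X - Polynomial.C a₁) * QA = Polynomial.C (1 / d₀) * Np := by
        have h := Polynomial.modByMonic_add_div (Polynomial.C (1 / d₀) * Np)
          (Polynomial.X - Polynomial.C a₁)
        rw [Polynomial.modByMonic_X_sub_C_eq_C_eval] at h
        exact ⟨_, _, h⟩
      have hstar : ∀ x : ℝ, x ^ 3 * (W.l₀ * lam * x - W.c) =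
          d₀ * (A₀ + (x - a₁) * Polynomial.aeval x QA) := fun x => by
        have h := congrArg (Polynomial.aeval x) hdiv
        simp only [map_add, map_mul, map_sub, Polynomial.aeval_C, Polynomial.aeval_X, eq_ratCast,
          hNx] at h
        push_cast at h
        rw [h, ← mul_assoc, mul_one_div_cancel hd₀0', one_mul]
      obtain ⟨M, hMdef⟩ : ∃ M : Polynomial ℚ, M = Polynomial.C (C₁ / (W.k * lam)) *
          (QA * D₂p - Polynomial.C (lam ^ 2 / d₀) * Np * (Polynomial.X + Polynomial.C a₁)) :=
        ⟨_, rfl⟩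
      have hMx : ∀ x : ℝ, Polynomial.aeval x M = (C₁ : ℝ) / (W.k * lam) *
          (Polynomial.aeval x QA * (-(W.c : ℝ) + (lam : ℝ) ^ 2 * x ^ 2) -
            (lam : ℝ) ^ 2 / d₀ * (x ^ 3 * (W.l₀ * lam * x - W.c)) * (x + a₁)) := fun x => by
        rw [hMdef]
        simp only [map_mul, map_sub, map_add, Polynomial.aeval_C, Polynomial.aeval_X, eq_ratCast,
          hNx, hD₂x]
        push_cast
        ring
      refine InBaker.peel_sqrt_const e M D₂p (-1) 1 (fun x _ _ => by
          rw [hD₂x]; exact (hD₂pos x).ne') r₁ (fun v hv => ?_)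
        (fun v => ((C₁ / (W.k * lam) * A₀ : ℚ) : ℝ) / (v 0 - a₁) * √(qD 0 0 e (v 0)))
        (fun v hv => ?_) (fun rA hdA hiA => ?_) fun rB hdB hiB => ?_
      · have h := abs_le.1 (hb₁ v hv)
        push_cast
        exact ⟨h.1, h.2⟩
      · -- the decomposition
        have ht : v 0 - (a₁ : ℝ) ≠ 0 := fun h => by
          apply hD₁' v hv
          rw [hp₁a, show v 0 = a₁ by linarith]
          ring
        rw [hi₁, hRx]
        beta_reduce
        rw [hMx, hD₂x, hqD, ← hu_def, hp₁a]
        push_cast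
        exact double_peel_identity (C₁ : ℝ) W.k lam a₁ W.c W.l₀ d₀ (Polynomial.aeval (v 0) QA) A₀ u
          (v 0) hkl ht (hD₂pos _).ne' (by exact_mod_cast hd₀def) hd₀0' (hstar (v 0))
      · refine InBaker.sqrt_const_div_W_sym e hepos (-W.c) (lam ^ 2) (neg_pos.2 hc) (sq_nonneg _)
          M rA (fun v hv => hb₁ v (by rw [hdA] at hv; exact hv)) ?_
        rw [hD₂p] at hiA
        exact hiA
      · exact InBaker.sqrt_const_pole e a₁ (C₁ / (W.k * lam) * A₀) hepos rB hiB

end Summit.KontsevichZagierPeriods.RootDecompWalshStrata.ConicDescent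

end
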